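import Summits.CriticalPhenomena.PercolationContinuityZ3.Theorems.PercNearOneGluingNoHeavyPcintDefectWordStructure
import Summits.CriticalPhenomena.PercolationContinuityZ3.Theorems.PercNearOneGluingNoHeavyPcintDefectWordUnique
import Summits.CriticalPhenomena.PercolationContinuityZ3.Theorems.PercNearOneGluingNoHeavyPcintClosingWordCount
import HarnessLib

/-!
# CriticalPhenomena/PercolationContinuityZ3 — Theorems/PercNearOneGluingNoHeavyPcintDefectWordCount.lean: `fullClosingCount (m−1) (2m) = (m−1)!·2^{m−1}·#defectSet` — the `2m`-gons spanning `m − 1` axes are the labelled oriented ONE-DEFECT STRUCTURES (mechanism theorem of STRUCTURE law C5-L4, part 5)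

Lane prim-pcint, STRUCTURE rule «numerics ⇒ structure ⇒ conjecture» (prim-pcint-2 GEN 21); sequel of …PcintDefectWordStructure and
…PcintDefectWordUnique, the one-defect analogue of …PcintClosingWordCount.
Fix a one-defect structure `(π, a, b)` on the `2m` points whose two switched diagrams are irreducible.  Its REDUCED OPENERS (the openers of
`π` other than `b`) number `m − 1`; a labelling of them by the `m − 1` axes (a bijection) and a choice of signs determines the word `dmkWord`:
the chord of `b` carries the reversed letter of the chord of `a`, partners off the 4-block carry reversed letters and partners inside it equal
letters.  This word is fully compatible with `(π, a, b)` (`fcompat_dmkWord`), hence self-avoiding (…PcintDefectWordDiagram), and every compatible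
full closing word arises exactly once (`card_dfibre = (m−1)!·2^{m−1}`).  Conversely every closing word of length `2m − 1` spanning `m − 1` axes
is compatible with exactly one structure (…Structure, …Unique), whose switched diagrams are irreducible.  The summation over structures
(`fullClosingCount (k+1) (2(k+2)) = (k+1)!·2^(k+1)·#defectSet (Fin (2(k+2)))`) and the sub-leading polygon coefficient follow in the sequel
…PcintPolygonSubleadingLaw.

HONEST FRAMING: elementary finite combinatorics; the mechanism half of law C5-L4 for all `m` (the closed form for `#defectSet` is the typed
conjecture `oneDefect` of …PcintSubleadingChordLaw).  No `sorry`; standard axioms.  Written by prim-pcint-2 gen 21 (prover-prim-pcint-2-g21-0),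
2026-08-27.
-/

noncomputable section

namespace Summit.CriticalPhenomena.PercolationContinuityZ3.Theorems.Pcint.ChordDiag

open scoped Nat
open Literature.Probability.LatticeModels Literature.Probability.Percolation
open Summit.CriticalPhenomena.PercolationContinuityZ3.Theorems.Pcint
open Summit.CriticalPhenomena.PercolationContinuityZ3.Theorems.Pcint.MemoryTail

variable {K k j : ℕ}

/-! ### The real openers of the marked chords -/

section Marked

variable {π : Fin (K + 1) → Fin (K + 1)} {a b : Fin (K + 1)}

/-- A point below its partner is a real letter and an opener. [folklore] -/
theorem exists_opener_of_lt {x : Fin (K + 1)} (hx : x < π x) : ∃ s : Fin K, Fin.castSucc s = x ∧ s ∈ openers π := by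
  obtain ⟨s, hs⟩ := Fin.exists_castSucc_eq.2 (hx.trans_le (Fin.le_last _)).ne
  exact ⟨s, hs, mem_openers.2 (by rw [hs]; exact hx)⟩

/-- An opener in the 4-block opens one of the two marked chords. [folklore] -/
theorem eq_or_eq_of_opener_mem_quad (h : IsPair π a b) {o : Fin K} (ho : o ∈ openers π)
    (hq : Fin.castSucc o ∈ quad π a b) (hd : IsDiag π) : Fin.castSucc o = a ∨ Fin.castSucc o = b := by
  have hlt := mem_openers.1 ho
  rcases mem_quad.1 hq with e | e | e | e
  · exact Or.inl e
  · exfalso; rw [e, (hd a).1] at hlt; exact lt_asymm hlt h.1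
  · exact Or.inr e
  · exfalso; rw [e, (hd b).1] at hlt; exact lt_asymm hlt h.2.1

/-- On the 4-block partners carry equal letters. [folklore] -/
theorem FCompat.apply_pi_of_mem_quad {W : Fin (K + 1) → Fin j × Bool} (hd : IsDiag π) (hW : FCompat π a b W) {x : Fin (K + 1)}
    (hx : x ∈ quad π a b) : W (π x) = W x := by
  obtain ⟨h1, h2, -⟩ := hW.2.1
  rcases mem_quad.1 hx with rfl | rfl | rfl | rfl
  · exact h1
  · rw [(hd a).1, h1]
  · exact h2
  · rw [(hd b).1, h2]

end Marked

/-! ### The word of a labelled oriented one-defect structure -/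

section MkWord

variable {π : Fin (K + 1) → Fin (K + 1)} {a b : Fin (K + 1)} {a₀ b₀ : Fin K}

/-- The letter of the chord opened by `o`: its label and sign, the chord of `b₀` carrying the reversed letter of the chord of `a₀`
(junk off the openers). [folklore] -/
def baseL (π : Fin (K + 1) → Fin (K + 1)) (a₀ b₀ : Fin K)
    (e : (↥((openers π).erase b₀) ↪ Fin (k + 1)) × (↥((openers π).erase b₀) → Bool)) (o : Fin K) : Fin (k + 1) × Bool :=
  if h : o ∈ (openers π).erase b₀ then (e.1 ⟨o, h⟩, e.2 ⟨o, h⟩)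
  else if h' : a₀ ∈ (openers π).erase b₀ then srev (e.1 ⟨a₀, h'⟩, e.2 ⟨a₀, h'⟩) else (0, false)

/-- **The word of a labelled oriented one-defect structure**: openers carry the letter of their chord, partners inside the 4-block the same
letter, partners outside it the reversed letter. [folklore] -/
def dmkWord (π : Fin (K + 1) → Fin (K + 1)) (a b : Fin (K + 1)) (a₀ b₀ : Fin K)
    (e : (↥((openers π).erase b₀) ↪ Fin (k + 1)) × (↥((openers π).erase b₀) → Bool)) : Fin K → Fin (k + 1) × Bool :=
  fun s => if s ∈ openers π then baseL π a₀ b₀ e s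
    else if Fin.castSucc s ∈ quad π a b then baseL π a₀ b₀ e (pre π s) else srev (baseL π a₀ b₀ e (pre π s))

/-- The virtual closing letter of `dmkWord`. [folklore] -/
def dmkV (π : Fin (K + 1) → Fin (K + 1)) (a b : Fin (K + 1)) (a₀ b₀ : Fin K) (hd : IsDiag π)
    (e : (↥((openers π).erase b₀) ↪ Fin (k + 1)) × (↥((openers π).erase b₀) → Bool)) : Fin (k + 1) × Bool :=
  if Fin.last K ∈ quad π a b then baseL π a₀ b₀ e (lone hd) else srev (baseL π a₀ b₀ e (lone hd))

variable (hd : IsDiag π) (h : IsPair π a b) (ha : Fin.castSucc a₀ = a) (hb : Fin.castSucc b₀ = b)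
  (e : (↥((openers π).erase b₀) ↪ Fin (k + 1)) × (↥((openers π).erase b₀) → Bool))

include ha h in
/-- `a₀` is a reduced opener. [folklore] -/
theorem a₀_mem (hb : Fin.castSucc b₀ = b) : a₀ ∈ (openers π).erase b₀ := by
  rw [Finset.mem_erase, mem_openers, ha]
  exact ⟨fun e => h.2.2.1.ne (by rw [← ha, ← hb, e]), h.1⟩

/-- `baseL` at a reduced opener. [folklore] -/
theorem baseL_of_mem {o : Fin K} (ho : o ∈ (openers π).erase b₀) : baseL π a₀ b₀ e o = (e.1 ⟨o, ho⟩, e.2 ⟨o, ho⟩) := by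
  simp [baseL, ho]

include ha h in
/-- `baseL` at `b₀`: the reversed letter of the chord of `a₀`. [folklore] -/
theorem baseL_b₀ (hb : Fin.castSucc b₀ = b) : baseL π a₀ b₀ e b₀ = srev (baseL π a₀ b₀ e a₀) := by
  have ha' := a₀_mem h ha hb
  rw [baseL_of_mem e ha']
  simp [baseL, ha']

include ha h in
/-- The axis of `baseL` at an opener: the label of the opener, `b₀` carrying the label of `a₀`. [folklore] -/
theorem baseL_fst_eq (hb : Fin.castSucc b₀ = b) {o o' : Fin K} (ho : o ∈ openers π) (ho' : o' ∈ openers π)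
    (hax : (baseL π a₀ b₀ e o).1 = (baseL π a₀ b₀ e o').1) : o = o' ∨ (o ∈ ({a₀, b₀} : Finset (Fin K)) ∧ o' ∈ ({a₀, b₀} : Finset (Fin K))) := by
  have ha' := a₀_mem h ha hb
  -- the label function on openers, `b₀ ↦ label a₀`
  have lab : ∀ {o} (ho : o ∈ openers π), ∃ r : ↥((openers π).erase b₀), (baseL π a₀ b₀ e o).1 = e.1 r ∧ (o = r.1 ∨ (o = b₀ ∧ r.1 = a₀)) := by
    intro o ho
    by_cases hob : o = b₀
    · subst hob; exact ⟨⟨a₀, ha'⟩, by rw [baseL_b₀ h ha e hb, baseL_of_mem e ha']; rfl, Or.inr ⟨rfl, rfl⟩⟩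
    · have hom : o ∈ (openers π).erase b₀ := Finset.mem_erase.2 ⟨hob, ho⟩
      exact ⟨⟨o, hom⟩, by rw [baseL_of_mem e hom], Or.inl rfl⟩
  obtain ⟨r, hr, hor⟩ := lab ho
  obtain ⟨r', hr', hor'⟩ := lab ho'
  rw [hr, hr'] at hax
  have hrr : r = r' := e.1.injective hax
  subst hrr
  rcases hor with h1 | ⟨h1, h2⟩ <;> rcases hor' with h1' | ⟨h1', h2'⟩
  · exact Or.inl (h1.trans h1'.symm)
  · right; rw [h1, h2', h1']; simp
  · right; rw [h1', h2, h1]; simp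
  · exact Or.inl (h1.trans h1'.symm)

/-- `dmkWord` at an opener. [folklore] -/
theorem dmkWord_of_mem {s : Fin K} (hs : s ∈ openers π) : dmkWord π a b a₀ b₀ e s = baseL π a₀ b₀ e s := if_pos hs

/-- `dmkWord` at a non-opener inside the 4-block. [folklore] -/
theorem dmkWord_of_quad {s : Fin K} (hs : s ∉ openers π) (hq : Fin.castSucc s ∈ quad π a b) :
    dmkWord π a b a₀ b₀ e s = baseL π a₀ b₀ e (pre π s) := by
  unfold dmkWord; rw [if_neg hs, if_pos hq]

/-- `dmkWord` at a non-opener outside the 4-block. [folklore] -/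
theorem dmkWord_of_not_quad {s : Fin K} (hs : s ∉ openers π) (hq : Fin.castSucc s ∉ quad π a b) :
    dmkWord π a b a₀ b₀ e s = srev (baseL π a₀ b₀ e (pre π s)) := by
  unfold dmkWord; rw [if_neg hs, if_neg hq]

/-- The OPENER OF A POINT: itself for an opener, else the opener of its chord (the lone letter for the closing point). [folklore] -/
def opOf (π : Fin (K + 1) → Fin (K + 1)) (hd : IsDiag π) (x : Fin (K + 1)) : Fin K :=
  Fin.lastCases (lone hd) (fun s => if s ∈ openers π then s else pre π s) x

include hd in
/-- **The extended word, uniformly**: every point carries the letter of its chord's opener, reversed iff it is the non-opener of a chord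
outside the 4-block. [folklore] -/
theorem ext_dmkWord_eq (x : Fin (K + 1)) :
    opOf π hd x ∈ openers π ∧ (x = Fin.castSucc (opOf π hd x) ∨ x = π (Fin.castSucc (opOf π hd x))) ∧
      ext (dmkWord π a b a₀ b₀ e) (dmkV π a b a₀ b₀ hd e) x =
        (if x = Fin.castSucc (opOf π hd x) ∨ x ∈ quad π a b then baseL π a₀ b₀ e (opOf π hd x)
          else srev (baseL π a₀ b₀ e (opOf π hd x))) := by
  induction x using Fin.lastCases with
  | last =>
    have hop : opOf π hd (Fin.last K) = lone hd := by simp [opOf]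
    rw [hop, ext_last, castSucc_lone]
    refine ⟨lone_mem_openers hd, Or.inr (hd _).1.symm, ?_⟩
    have hne : Fin.last K ≠ π (Fin.last K) := fun h' => (hd _).2 h'.symm
    unfold dmkV
    by_cases hq : Fin.last K ∈ quad π a b
    · rw [if_pos hq, if_pos (Or.inr hq)]
    · rw [if_neg hq, if_neg (by push Not; exact ⟨hne, hq⟩)]
  | cast s =>
    rw [ext_castSucc]
    by_cases hs : s ∈ openers π
    · have hop : opOf π hd (Fin.castSucc s) = s := by simp [opOf, hs]
      rw [hop, dmkWord_of_mem e hs, if_pos (Or.inl rfl)]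
      exact ⟨hs, Or.inl rfl, rfl⟩
    · have hop : opOf π hd (Fin.castSucc s) = pre π s := by simp [opOf, hs]
      obtain ⟨h1, h2⟩ := pre_of_not_mem hd hs
      have h3 : Fin.castSucc s = π (Fin.castSucc (pre π s)) := by rw [← h1, (hd _).1]
      have hne : Fin.castSucc s ≠ Fin.castSucc (pre π s) := by
        intro h'; rw [← h'] at h3; exact (hd _).2 h3.symm
      rw [hop]
      refine ⟨h2, Or.inr h3, ?_⟩
      by_cases hq : Fin.castSucc s ∈ quad π a b
      · rw [dmkWord_of_quad e hs hq, if_pos (Or.inr hq)]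
      · rw [dmkWord_of_not_quad e hs hq, if_neg (by push Not; exact ⟨hne, hq⟩)]

include hd h ha hb in
/-- **The word of a labelled oriented one-defect structure is fully compatible with it.** [folklore] -/
theorem fcompat_dmkWord : FCompat π a b (ext (dmkWord π a b a₀ b₀ e) (dmkV π a b a₀ b₀ hd e)) := by
  set W := ext (dmkWord π a b a₀ b₀ e) (dmkV π a b a₀ b₀ hd e) with hWdef
  have hE := ext_dmkWord_eq hd e (a := a) (b := b) (a₀ := a₀) (b₀ := b₀)
  have ha0 : a₀ ∈ openers π := (Finset.mem_erase.1 (a₀_mem h ha hb)).2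
  have hb0 : b₀ ∈ openers π := mem_openers.2 (by rw [hb]; exact h.2.1)
  -- the opener of a point in terms of its chord
  have op_eq : ∀ {x : Fin (K + 1)} {o : Fin K}, o ∈ openers π → (x = Fin.castSucc o ∨ x = π (Fin.castSucc o)) → opOf π hd x = o := by
    intro x o ho hx
    obtain ⟨ho', hx', -⟩ := hE x
    -- two openers whose chords share the point `x` coincide
    have key : ∀ {o o' : Fin K}, o ∈ openers π → o' ∈ openers π →
        (x = Fin.castSucc o ∨ x = π (Fin.castSucc o)) → (x = Fin.castSucc o' ∨ x = π (Fin.castSucc o')) → o = o' := by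
      intro o o' ho ho' h1 h2
      have lo := mem_openers.1 ho
      have lo' := mem_openers.1 ho'
      rcases h1 with h1 | h1 <;> rcases h2 with h2 | h2
      · exact Fin.castSucc_injective _ (h1.symm.trans h2)
      · exfalso
        have e3 : π (Fin.castSucc o') = Fin.castSucc o := h2.symm.trans h1
        have e4 : π (Fin.castSucc o) = Fin.castSucc o' := by rw [← e3, (hd _).1]
        rw [e4] at lo; rw [e3] at lo'; exact lt_asymm lo lo'
      · exfalso
        have e3 : π (Fin.castSucc o) = Fin.castSucc o' := h1.symm.trans h2
        have e4 : π (Fin.castSucc o') = Fin.castSucc o := by rw [← e3, (hd _).1]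
        rw [e3] at lo; rw [e4] at lo'; exact lt_asymm lo lo'
      · exact Fin.castSucc_injective _ (hd.injective (h1.symm.trans h2))
    exact key ho' ho hx' hx
  refine ⟨fun x hx => ?_, ⟨?_, ?_, ?_⟩, fun x y hxy hax => ?_⟩
  · -- off the 4-block: reversed letters
    obtain ⟨ho, hx', hWx⟩ := hE x
    set o := opOf π hd x
    have hπx : π x = Fin.castSucc o ∨ π x = π (Fin.castSucc o) := by
      rcases hx' with e1 | e1
      · exact Or.inr (by rw [e1])
      · exact Or.inl (by rw [e1, (hd _).1])
    have hopx : opOf π hd (π x) = o := op_eq ho hπx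
    obtain ⟨-, -, hWpx⟩ := hE (π x)
    rw [hopx] at hWpx
    have hpq : π x ∉ quad π a b := fun h' => hx ((mem_quad_apply hd).1 h')
    show W (π x) = srev (W x)
    rw [hWdef, hWx, hWpx]
    rcases hx' with e1 | e1
    · have hne : π x ≠ Fin.castSucc o := by rw [← e1]; exact (hd x).2
      rw [if_neg (by push Not; exact ⟨hne, hpq⟩), if_pos (Or.inl e1)]
    · have hne : x ≠ Fin.castSucc o := by intro h'; rw [h'] at e1; exact (hd _).2 e1.symm
      rw [if_pos (Or.inl (by rw [e1, (hd _).1])), if_neg (by push Not; exact ⟨hne, hx⟩), srev_srev]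
  · -- `W (π a) = W a`
    have hq : π a ∈ quad π a b := mem_quad.2 (Or.inr (Or.inl rfl))
    obtain ⟨-, -, h1⟩ := hE (π a)
    obtain ⟨-, -, h2⟩ := hE a
    show W (π a) = W a
    rw [hWdef, h1, h2, op_eq ha0 (Or.inr (by rw [ha])), op_eq ha0 (Or.inl ha.symm), if_pos (Or.inr hq),
      if_pos (Or.inl ha.symm)]
  · have hq : π b ∈ quad π a b := mem_quad.2 (Or.inr (Or.inr (Or.inr rfl)))
    obtain ⟨-, -, h1⟩ := hE (π b)
    obtain ⟨-, -, h2⟩ := hE b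
    show W (π b) = W b
    rw [hWdef, h1, h2, op_eq hb0 (Or.inr (by rw [hb])), op_eq hb0 (Or.inl hb.symm), if_pos (Or.inr hq),
      if_pos (Or.inl hb.symm)]
  · obtain ⟨-, -, h1⟩ := hE b
    obtain ⟨-, -, h2⟩ := hE a
    show W b = srev (W a)
    rw [hWdef, h1, h2, op_eq hb0 (Or.inl hb.symm), op_eq ha0 (Or.inl ha.symm), if_pos (Or.inl hb.symm),
      if_pos (Or.inl ha.symm), baseL_b₀ h ha e hb]
  · -- equal axes: same chord, or both marked chords
    obtain ⟨ho, hx', hWx⟩ := hE x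
    obtain ⟨ho', hy', hWy⟩ := hE y
    have hax' : (baseL π a₀ b₀ e (opOf π hd x)).1 = (baseL π a₀ b₀ e (opOf π hd y)).1 := by
      have e1 : (W x).1 = (baseL π a₀ b₀ e (opOf π hd x)).1 := by
        rw [hWdef, hWx]; split_ifs <;> simp [srev]
      have e2 : (W y).1 = (baseL π a₀ b₀ e (opOf π hd y)).1 := by
        rw [hWdef, hWy]; split_ifs <;> simp [srev]
      rw [← e1, ← e2]; exact hax
    rcases baseL_fst_eq h ha e hb ho ho' hax' with heq | ⟨hm, hm'⟩
    · -- same chord: `y = π x`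
      left
      rw [heq] at hx'
      rcases hx' with e1 | e1 <;> rcases hy' with e2 | e2
      · exact absurd (e1.trans e2.symm) hxy
      · rw [e1]; exact e2.symm
      · rw [e1, (hd _).1]; exact e2.symm
      · exact absurd (e1.trans e2.symm) hxy
    · -- both marked chords: both points in the 4-block
      right
      have memq : ∀ {z : Fin (K + 1)} {o : Fin K}, o ∈ ({a₀, b₀} : Finset (Fin K)) →
          (z = Fin.castSucc o ∨ z = π (Fin.castSucc o)) → z ∈ quad π a b := by
        intro z o ho hz
        rw [Finset.mem_insert, Finset.mem_singleton] at ho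
        rw [mem_quad]
        rcases ho with ho | ho <;> rcases hz with hz | hz <;> rw [hz, ho]
        · exact Or.inl ha
        · exact Or.inr (Or.inl (by rw [ha]))
        · exact Or.inr (Or.inr (Or.inl hb))
        · exact Or.inr (Or.inr (Or.inr (by rw [hb])))
      exact ⟨memq hm hx', memq hm' hy'⟩

end MkWord


/-! ### The fibre over a structure -/

open Classical in
/-- The fibre over `(π, a, b)`: the full closing words compatible with it. [folklore] -/
def dfibre (k : ℕ) (t : (Fin (K + 1) → Fin (K + 1)) × Fin (K + 1) × Fin (K + 1)) : Finset (Fin K → Fin (k + 1) × Bool) :=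
  (fullWords K k).filter fun w => DCompat t.1 t.2.1 t.2.2 w

/-- **The fibre over a structure with irreducible switched diagrams has `(k+1)!·2^(k+1)` words** (`K + 1 = 2(k+2)`). [folklore] -/
theorem card_dfibre (hK : K + 1 = 2 * (k + 2)) {π : Fin (K + 1) → Fin (K + 1)} {a b : Fin (K + 1)} (hd : IsDiag π) (h : IsPair π a b)
    (hgP : IsGood (switchP π a b)) (hgX : IsGood (switchX π a b)) : (dfibre k (π, a, b)).card = (k + 1)! * 2 ^ (k + 1) := by
  classical
  obtain ⟨a₀, ha, ha0⟩ := exists_opener_of_lt h.1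
  obtain ⟨b₀, hb, hb0⟩ := exists_opener_of_lt h.2.1
  have hab : a₀ ≠ b₀ := fun e => h.2.2.1.ne (by rw [← ha, ← hb, e])
  have hcard : (openers π).card = k + 2 := by have := two_mul_card_openers hd; omega
  have hO : ((openers π).erase b₀).card = k + 1 := by rw [Finset.card_erase_of_mem hb0, hcard]; omega
  have hE : Fintype.card ((↥((openers π).erase b₀) ↪ Fin (k + 1)) × (↥((openers π).erase b₀) → Bool)) = (k + 1)! * 2 ^ (k + 1) := by
    rw [Fintype.card_prod, Fintype.card_embedding_eq, Fintype.card_fun, Fintype.card_bool, Fintype.card_coe, hO,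
      Fintype.card_fin, Nat.descFactorial_self]
  rw [← hE, ← Finset.card_univ]
  symm
  refine Finset.card_nbij (dmkWord π a b a₀ b₀) ?_ ?_ ?_
  · -- into the fibre
    intro e _
    have hc := fcompat_dmkWord hd h ha hb e
    rw [Finset.mem_coe, dfibre, Finset.mem_filter, mem_fullWords]
    refine ⟨⟨(isSAW_iff_isGood_switch hd h hc).2 ⟨hgP, hgX⟩, (l1_wordPos_length_of_fcompat hd h hc).le, fun c => ?_⟩, ⟨_, hc⟩⟩
    have hbij : Function.Bijective e.1 :=
      (Fintype.bijective_iff_injective_and_card _).2 ⟨e.1.injective, by rw [Fintype.card_coe, hO, Fintype.card_fin]⟩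
    obtain ⟨⟨o, ho⟩, hoc⟩ := hbij.2 c
    refine ⟨o, ?_⟩
    rw [dmkWord_of_mem e (Finset.mem_erase.1 ho).2, baseL_of_mem e ho]
    exact hoc
  · -- injective
    intro e _ e' _ hee
    have key : ∀ o (ho : o ∈ (openers π).erase b₀), (e.1 ⟨o, ho⟩, e.2 ⟨o, ho⟩) = (e'.1 ⟨o, ho⟩, e'.2 ⟨o, ho⟩) := by
      intro o ho
      have ho' := (Finset.mem_erase.1 ho).2
      rw [← baseL_of_mem e ho, ← baseL_of_mem e' ho, ← dmkWord_of_mem e ho', ← dmkWord_of_mem e' ho', hee]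
    refine Prod.ext (Function.Embedding.ext fun o => ?_) (funext fun o => ?_)
    · have := key o.1 o.2; simp only [Prod.mk.injEq] at this; exact this.1
    · have := key o.1 o.2; simp only [Prod.mk.injEq] at this; exact this.2
  · -- onto the fibre
    intro w hw
    rw [Finset.mem_coe, dfibre, Finset.mem_filter] at hw
    obtain ⟨-, v, hW⟩ := hw
    dsimp only at hW
    -- the labelling read off `w`
    have hinj : Function.Injective fun o : ↥((openers π).erase b₀) => (w o.1).1 := by
      rintro ⟨o, ho⟩ ⟨o', ho'⟩ hoo
      obtain ⟨hob, hoo1⟩ := Finset.mem_erase.1 ho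
      obtain ⟨hob', hoo2⟩ := Finset.mem_erase.1 ho'
      by_contra hne
      have hne' : Fin.castSucc o ≠ Fin.castSucc o' := fun e => hne (Subtype.ext (Fin.castSucc_injective _ e))
      have hax : (ext w v (Fin.castSucc o)).1 = (ext w v (Fin.castSucc o')).1 := by rw [ext_castSucc, ext_castSucc]; exact hoo
      rcases hW.2.2 _ _ hne' hax with h1 | ⟨h1, h2⟩
      · have l1 := mem_openers.1 hoo1
        have l2 := mem_openers.1 hoo2
        have e2 : π (Fin.castSucc o') = Fin.castSucc o := by rw [← h1, (hd _).1]
        rw [h1] at l1; rw [e2] at l2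
        exact lt_asymm l1 l2
      · rcases eq_or_eq_of_opener_mem_quad h hoo1 h1 hd with e1 | e1 <;>
          rcases eq_or_eq_of_opener_mem_quad h hoo2 h2 hd with e2 | e2
        · exact hne' (e1.trans e2.symm)
        · exact hob' (Fin.castSucc_injective _ (e2.trans hb.symm))
        · exact hob (Fin.castSucc_injective _ (e1.trans hb.symm))
        · exact hob (Fin.castSucc_injective _ (e1.trans hb.symm))
    set e : (↥((openers π).erase b₀) ↪ Fin (k + 1)) × (↥((openers π).erase b₀) → Bool) :=
      (⟨fun o => (w o.1).1, hinj⟩, fun o => (w o.1).2) with he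
    refine ⟨e, Finset.mem_coe.2 (Finset.mem_univ _), ?_⟩
    -- openers carry `baseL`
    have hbase : ∀ o, o ∈ openers π → baseL π a₀ b₀ e o = w o := by
      intro o ho
      by_cases hob : o = b₀
      · subst hob
        rw [baseL_b₀ h ha e hb, baseL_of_mem e (a₀_mem h ha hb)]
        have := hW.2.1.2.2
        rw [← ha, ← hb, ext_castSucc, ext_castSucc] at this
        rw [this]; rfl
      · rw [baseL_of_mem e (Finset.mem_erase.2 ⟨hob, ho⟩)]; rfl
    funext s
    by_cases hs : s ∈ openers π
    · rw [dmkWord_of_mem e hs, hbase s hs]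
    · obtain ⟨h1, h2⟩ := pre_of_not_mem hd hs
      have h3 : π (Fin.castSucc (pre π s)) = Fin.castSucc s := by rw [← h1, (hd _).1]
      by_cases hq : Fin.castSucc s ∈ quad π a b
      · rw [dmkWord_of_quad e hs hq, hbase _ h2]
        have hq' : Fin.castSucc (pre π s) ∈ quad π a b := by rw [← mem_quad_apply hd, h3]; exact hq
        have := hW.apply_pi_of_mem_quad hd hq'
        rw [h3, ext_castSucc, ext_castSucc] at this
        exact this.symm
      · rw [dmkWord_of_not_quad e hs hq, hbase _ h2]
        have hq' : Fin.castSucc (pre π s) ∉ quad π a b := by rw [← mem_quad_apply hd, h3]; exact hq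
        have := hW.1 _ hq'
        rw [h3, ext_castSucc, ext_castSucc] at this
        exact this.symm

end Summit.CriticalPhenomena.PercolationContinuityZ3.Theorems.Pcint.ChordDiag
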